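import Summits.Schanuel.Schanuel.Theorems.ZilberEacBranchRamifiedWitness
import Summits.Schanuel.Schanuel.Theorems.ZilberEacBranchRamifiedTrichotomy
import Summits.Schanuel.Schanuel.Theorems.ZilberEacBranchExpAlgebraic
import HarnessLib

/-!
# Arbitrary base branches, IV: non-density over an ARBITRARY base branch with `ord x₁ > ord x₀`
# makes the logarithm of the fibre branch ALGEBRAIC

HONEST FRAMING.  Cell `pub-schanuel` (Zilber's Exponential-Algebraic Closedness, case ladder;
host summit Schanuel), seat 2, gen 28.  Files LXII (graphs) and LXXVII (polynomial curves) prove: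
if a surface of fibre-curve type is NOT dense then the logarithm of a branch of the fibre curve is
algebraic over `ℂ(x₀)` near a far point.  This file proves the statement for an ARBITRARY
irreducible closed `S ⊆ ℂ² × ℂ²` of dimension `≤ 2` and an ARBITRARY analytic base branch:
**`exists_algebraic_log_of_not_dense_branch`**.  DATA: `k ≥ 1`, `M ≥ k + 1`; `ψ` analytic at `0`,
`ψ(0) = θ ≠ 0`; `Φ` analytic at `0`, `Φ(0) ≠ 0`; along the punctured germ `s → 0` the points
`(x₀, x₁, y₀, y₁) = (s^{-k}, Φ(s)s^{-M}, ψ(s), e^{Φ(s)s^{-M}})` lie in `S` (a cylinder germ at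
infinity of `S` over the base branch `(s^{-k}, Φ(s)s^{-M})` — `x₁` grows FASTER than `x₀`), the fibre
relation `F(s^{-k}, ψ(s)) = 0` and the base relation `A(s^{-k}, Φ(s)s^{-M}) = 0` hold for irreducible
`F, A ∈ ℂ[s][t]` of positive `t`-degree.  CONCLUSION: if `I(S ∩ Γ_exp) ≠ I(S)` then at some large
real `z₀` the branch `ρ(z) = ψ(z^{-1/k})` of `F(z, ·) = 0` has a logarithm `L = log(ρ/θ)` whose germ
is ALGEBRAIC over `ℂ[zGerm z₀]`.  Chain: chart (LVII) ⟶ witness (file I of this series) ⟶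
abstract trichotomy (file II) leaves `H(U(μ)μ^{-k}, e^{r(μ)}) = 0` ⟶ transported to `z = x₀` near
`z₀`: `H(z, exp(α(z) - Π(R z))) = 0` with `α(z) = Φ(z^{-1/k})z^{M/k}` the base branch as a function
of `x₀` (so `A(z, α z) = 0`, `α'` algebraic by file III), `2πi R^k = z - L - τ`,
`deg Π = M ≥ k + 1` ⟶ the algebraic core (file III).  Gen 25's theorems (file XLVIII) refute the
conclusion along any parametrised zero or pole branch of `F`: file V.  Complete classes of
instances of an OPEN question (Mantova–Masser, PLMS 2024 §1 p. 5); EC(3,2) OPEN; NOT Schanuel's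
conjecture (neither used nor implied); EAC ⇏ SC.
-/

noncomputable section

open Filter Topology Set Complex MvPolynomial
open Literature.NumberTheory.Transcendental Literature.ModelTheory.Zilber
open Literature.ModelTheory.ExponentialFields

set_option linter.dupNamespace false

namespace Summit.Schanuel.Schanuel.Theorems

/-- **Non-density over an arbitrary base branch makes the logarithm of the fibre branch
algebraic.**  See the module docstring.
[cite: MantovaMasser2023, §1 Further remarks, p. 5 (the question, open in general)] (new) -/
theorem exists_algebraic_log_of_not_dense_branch {S : Set (Fin 2 ⊕ Fin 2 → ℂ)}
    (hS : IsIrreducibleClosed ℂ S) (hdim : zariskiDim ℂ S ≤ (2 : ℕ))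
    (F : Polynomial (Polynomial ℂ)) (hFirr : Irreducible F) (hF1 : F.natDegree ≠ 0)
    (A : Polynomial (Polynomial ℂ)) (hAirr : Irreducible A) (hA1 : A.natDegree ≠ 0)
    {k M : ℕ} (hk : 1 ≤ k) (hM : k + 1 ≤ M)
    {ψ : ℂ → ℂ} (hψ : AnalyticAt ℂ ψ 0) {θ : ℂ} (hθ0 : θ ≠ 0) (hψ0 : ψ 0 = θ)
    {Φ : ℂ → ℂ} (hΦ : AnalyticAt ℂ Φ 0) (hΦ0 : Φ 0 ≠ 0)
    (hbranch : ∀ᶠ s in 𝓝[≠] (0 : ℂ), (F.map (Polynomial.evalRingHom (s ^ k)⁻¹)).eval (ψ s) = 0)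
    (hbase : ∀ᶠ s in 𝓝[≠] (0 : ℂ),
      (A.map (Polynomial.evalRingHom (s ^ k)⁻¹)).eval (Φ s * (s ^ M)⁻¹) = 0)
    (hgerm : ∀ᶠ s in 𝓝[≠] (0 : ℂ),
      (Sum.elim ![(s ^ k)⁻¹, Φ s * (s ^ M)⁻¹] ![ψ s, Complex.exp (Φ s * (s ^ M)⁻¹)] :
        Fin 2 ⊕ Fin 2 → ℂ) ∈ S)
    (hnot : ¬ UnprojectedDense S) :
    ∃ (z₀ : ℂ) (ρ L : ℂ → ℂ) (hLan : AnalyticAt ℂ L z₀), AnalyticAt ℂ ρ z₀ ∧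
      ρ z₀ ≠ 0 ∧ (∀ᶠ z in 𝓝 z₀, (F.map (Polynomial.evalRingHom z)).eval (ρ z) = 0) ∧
      (∀ᶠ z in 𝓝 z₀, HasDerivAt L (deriv ρ z / ρ z) z) ∧
      IsAlgebraic (Algebra.adjoin ℂ ({zGerm z₀} : Set (AGerm z₀))) (AGerm.mk z₀ hLan) := by
  classical
  have hk0 : k ≠ 0 := by omega
  have hkC : (k : ℂ) ≠ 0 := Nat.cast_ne_zero.2 hk0
  -- `θ = e^τ`
  set τ : ℂ := Complex.log θ with hτdef
  have hτ : Complex.exp τ = θ := Complex.exp_log hθ0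
  -- chart, witness, and the sequence of exponential points on `S`
  obtain ⟨m, hman, hm0, hm', hchart⟩ := exists_ramifiedChart hψ hθ0 hψ0 τ hk
  obtain ⟨U, r, Pl, m₀, μ, σ, hUan, -, hran, -, hPlM, hside, hμ0, hμ, hσ0, hGσ, hxU, hexpσ, hnorm,
      -, hid₁⟩ :=
    exists_ramified_witness_branch hθ0 hτ hk hgerm hman hm0 hm' hchart hΦ M
  have hPl : Pl.natDegree = M := hPlM hΦ0
  set q : ℕ → Fin 2 ⊕ Fin 2 → ℂ := fun j =>
    Sum.elim ![(σ j ^ k)⁻¹, Φ (σ j) * (σ j ^ M)⁻¹]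
      ![ψ (σ j), Complex.exp (Φ (σ j) * (σ j ^ M)⁻¹)] with hq
  have hqS : ∀ j, q j ∈ S := fun j => hGσ j
  have hqΓ : ∀ j, q j ∈ expGraph ℂ 2 := by
    intro j
    rw [mem_expGraph_iff]
    intro i
    rw [Literature.ModelTheory.ExponentialFields.ExponentialRing.complex_exp_eq]
    fin_cases i
    · simp [hq, hexpσ j]
    · simp [hq]
  have hx : ∀ j, q j (Sum.inl 0) = U (μ j) * (μ j)⁻¹ ^ k := fun j => by
    simp only [hq, Sum.elim_inl, Matrix.cons_val_zero]
    exact hxU j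
  have hnorm' : Tendsto (fun j => ‖q j (Sum.inl 0)‖) atTop atTop := by
    refine hnorm.congr fun j => ?_
    simp [hq]
  have hid₁' : ∀ j, q j (Sum.inl 1) = Pl.eval ((m₀ + j : ℕ) : ℂ) + r (μ j) := fun j => by
    simp only [hq, Sum.elim_inl, Matrix.cons_val_one, Matrix.cons_val_zero]
    exact hid₁ j
  -- the relation left by non-density (abstract trichotomy)
  have hrel : ∃ H : Polynomial (Polynomial ℂ), H ≠ 0 ∧
      ∀ᶠ u in 𝓝[≠] (0 : ℂ), (H.map (Polynomial.evalRingHom (U u * u⁻¹ ^ k))).eval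
        (Complex.exp (r u)) = 0 := by
    by_contra htr'
    have htr : ∀ H : Polynomial (Polynomial ℂ), H ≠ 0 →
        ¬ (∀ᶠ u in 𝓝[≠] (0 : ℂ), (H.map (Polynomial.evalRingHom (U u * u⁻¹ ^ k))).eval
          (Complex.exp (r u)) = 0) :=
      fun H hH0 hH => htr' ⟨H, hH0, hH⟩
    exact hnot (unprojectedDense_of_ramified_witness_abstract hS hdim Pl hUan hran htr m₀ hμ0 hμ
      hqS hqΓ hx hnorm' hid₁')
  obtain ⟨H, hH0, hH⟩ := hrel
  -- the auxiliary bound `|ψ'(s) s^{k+1} / ψ(s)| < 1` near `0`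
  set G : ℂ → ℂ := fun s => deriv ψ s * s ^ (k + 1) / ψ s with hG
  have hGlim : Tendsto G (𝓝 0) (𝓝 0) := by
    have hcont : ContinuousAt G 0 :=
      ((hψ.deriv.continuousAt.mul (continuousAt_id.pow (k + 1))).div hψ.continuousAt
        (by rw [hψ0]; exact hθ0))
    have h := hcont.tendsto
    simp only [hG, zero_pow (Nat.succ_ne_zero k), mul_zero, zero_div] at h
    exact h
  have hGsmall : ∀ᶠ s in 𝓝 (0 : ℂ), ‖G s‖ < 1 := by
    have := hGlim.eventually (Metric.ball_mem_nhds (0 : ℂ) one_pos)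
    filter_upwards [this] with s hs
    rw [dist_zero_right] at hs
    exact hs
  have hΦne : ∀ᶠ s in 𝓝 (0 : ℂ), Φ s ≠ 0 := hΦ.continuousAt.eventually_ne hΦ0
  -- all `s`-side facts on a punctured disc
  have hmne : ∀ᶠ s in 𝓝[≠] (0 : ℂ), m s ≠ 0 := by
    refine eventually_nhdsWithin_iff.2 ?_
    filter_upwards [hchart] with s hs hs0 using (hs.2.2.2.2 hs0).1
  have hmtend : Tendsto m (𝓝[≠] (0 : ℂ)) (𝓝[≠] 0) := by
    refine tendsto_nhdsWithin_iff.2 ⟨?_, hmne⟩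
    have h := hman.continuousAt.tendsto
    rw [hm0] at h
    exact h.mono_left nhdsWithin_le_nhds
  have hfacts : ∀ᶠ s in 𝓝[≠] (0 : ℂ), AnalyticAt ℂ ψ s ∧ ψ s ≠ 0 ∧ ψ s / θ ∈ Complex.slitPlane ∧
      AnalyticAt ℂ m s ∧ m s ≠ 0 ∧
      (2 * Real.pi * I) * (m s ^ k)⁻¹ = (s ^ k)⁻¹ - Complex.log (ψ s / θ) - τ ∧
      (F.map (Polynomial.evalRingHom (s ^ k)⁻¹)).eval (ψ s) = 0 ∧
      (H.map (Polynomial.evalRingHom (s ^ k)⁻¹)).eval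
        (Complex.exp (Φ s * (s ^ M)⁻¹ - Pl.eval (m s)⁻¹)) = 0 ∧ ‖G s‖ < 1 ∧
      AnalyticAt ℂ Φ s ∧ Φ s ≠ 0 ∧
      (A.map (Polynomial.evalRingHom (s ^ k)⁻¹)).eval (Φ s * (s ^ M)⁻¹) = 0 := by
    filter_upwards [nhdsWithin_le_nhds hchart, nhdsWithin_le_nhds hman.eventually_analyticAt,
      hbranch, hside, hmtend.eventually hH, nhdsWithin_le_nhds hGsmall, self_mem_nhdsWithin,
      nhdsWithin_le_nhds hΦ.eventually_analyticAt, nhdsWithin_le_nhds hΦne, hbase]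
      with s hc hma hb hsd hHs hGs hs0 hΦa hΦs hAs
    obtain ⟨hψan, hψne, hslit, -, hc'⟩ := hc
    obtain ⟨hms, hid⟩ := hc' hs0
    obtain ⟨hU', hr'⟩ := hsd
    rw [hU', hr'] at hHs
    exact ⟨hψan, hψne, hslit, hma, hms, hid, hb, hHs, hGs, hΦa, hΦs, hAs⟩
  obtain ⟨δ, hδ, hball⟩ := Metric.eventually_nhds_iff.1 (eventually_nhdsWithin_iff.1 hfacts)
  -- the `z`-side: `s = sroot z = exp(-(1/k) log z)` near a large real point
  set sroot : ℂ → ℂ := fun z => Complex.exp (-(1 / (k : ℂ)) * Complex.log z) with hsroot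
  have hsroot_pow : ∀ z : ℂ, z ≠ 0 → sroot z ^ k = z⁻¹ := by
    intro z hz
    rw [hsroot, ← Complex.exp_nat_mul, ← mul_assoc, show ((k : ℂ)) * -(1 / (k : ℂ)) = -1 by
      field_simp, neg_one_mul, Complex.exp_neg, Complex.exp_log hz]
  have hsroot_ne : ∀ z, sroot z ≠ 0 := fun z => Complex.exp_ne_zero _
  have hsroot_an : ∀ z : ℂ, z ∈ Complex.slitPlane → AnalyticAt ℂ sroot z := fun z hz =>
    (analyticAt_const.mul (analyticAt_clog hz)).cexp
  have hsroot_deriv : ∀ z : ℂ, z ∈ Complex.slitPlane →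
      HasDerivAt sroot (sroot z * (-(1 / (k : ℂ)) * z⁻¹)) z := fun z hz =>
    ((Complex.hasDerivAt_log hz).const_mul (-(1 / (k : ℂ)))).cexp
  have hsroot_small : ∀ z : ℂ, δ⁻¹ ^ k < ‖z‖ → ‖sroot z‖ < δ := by
    intro z hz
    have hzpos : 0 < ‖z‖ := lt_of_le_of_lt (by positivity) hz
    have hz0 : z ≠ 0 := norm_pos_iff.1 hzpos
    refine lt_of_pow_lt_pow_left₀ k hδ.le ?_
    rw [← norm_pow, hsroot_pow z hz0, norm_inv]
    calc ‖z‖⁻¹ < (δ⁻¹ ^ k)⁻¹ := (inv_lt_inv₀ hzpos (by positivity)).2 hz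
      _ = δ ^ k := by rw [inv_pow, inv_inv]
  set z₀ : ℂ := ((δ⁻¹ ^ k + 1 : ℝ) : ℂ) with hz₀def
  have hz₀norm : δ⁻¹ ^ k < ‖z₀‖ := by
    rw [hz₀def, Complex.norm_real, Real.norm_eq_abs, abs_of_pos (by positivity)]; linarith
  have hz₀slit : z₀ ∈ Complex.slitPlane := by
    rw [hz₀def, Complex.ofReal_mem_slitPlane]; positivity
  have hnear : ∀ᶠ y in 𝓝 z₀, δ⁻¹ ^ k < ‖y‖ ∧ y ∈ Complex.slitPlane :=
    ((continuous_norm.continuousAt (x := z₀)).eventually (lt_mem_nhds hz₀norm)).and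
      (Complex.isOpen_slitPlane.mem_nhds hz₀slit)
  -- the facts at every good `z`
  have hgoodz : ∀ y : ℂ, δ⁻¹ ^ k < ‖y‖ → y ∈ Complex.slitPlane →
      y ≠ 0 ∧ AnalyticAt ℂ sroot y ∧ (sroot y ^ k)⁻¹ = y ∧
      AnalyticAt ℂ ψ (sroot y) ∧ ψ (sroot y) ≠ 0 ∧ ψ (sroot y) / θ ∈ Complex.slitPlane ∧
      AnalyticAt ℂ m (sroot y) ∧ m (sroot y) ≠ 0 ∧
      (2 * Real.pi * I) * (m (sroot y) ^ k)⁻¹ = y - Complex.log (ψ (sroot y) / θ) - τ ∧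
      (F.map (Polynomial.evalRingHom y)).eval (ψ (sroot y)) = 0 ∧
      (H.map (Polynomial.evalRingHom y)).eval
        (Complex.exp (Φ (sroot y) * (sroot y ^ M)⁻¹ - Pl.eval (m (sroot y))⁻¹)) = 0 ∧
      ‖G (sroot y)‖ < 1 ∧ AnalyticAt ℂ Φ (sroot y) ∧ Φ (sroot y) ≠ 0 ∧
      (A.map (Polynomial.evalRingHom y)).eval (Φ (sroot y) * (sroot y ^ M)⁻¹) = 0 := by
    intro y hy hslit
    have hypos : 0 < ‖y‖ := lt_of_le_of_lt (by positivity) hy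
    have hy0 : y ≠ 0 := norm_pos_iff.1 hypos
    have hinv : (sroot y ^ k)⁻¹ = y := by rw [hsroot_pow y hy0, inv_inv]
    obtain ⟨h1, h2, h3, h4, h5, h6, h7, h8, h9, h10, h11, h12⟩ :=
      hball (by rw [dist_zero_right]; exact hsroot_small y hy) (hsroot_ne y)
    rw [hinv] at h6 h7 h8 h12
    exact ⟨hy0, hsroot_an y hslit, hinv, h1, h2, h3, h4, h5, h6, h7, h8, h9, h10, h11, h12⟩
  obtain ⟨hz₀0, hsan₀, hinv₀, hψan₀, hψne₀, hslit₀, hman₀, hmne₀, -, -, -, hG₀, hΦan₀, hΦne₀, -⟩ :=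
    hgoodz z₀ hz₀norm hz₀slit
  -- the branch `ρ = ψ ∘ sroot`, its logarithm, its logarithmic derivative, `R = 1/(m ∘ sroot)`,
  -- and the base branch `α = (Φ ∘ sroot)·sroot^{-M}` as a function of `x₀`
  set ρ : ℂ → ℂ := fun y => ψ (sroot y) with hρ
  set L : ℂ → ℂ := fun y => Complex.log (ρ y / θ) with hL
  set g : ℂ → ℂ := fun y => deriv ρ y / ρ y with hg
  set Rf : ℂ → ℂ := fun y => (m (sroot y))⁻¹ with hRf
  set α : ℂ → ℂ := fun y => Φ (sroot y) * (sroot y ^ M)⁻¹ with hα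
  have hρan : ∀ y : ℂ, δ⁻¹ ^ k < ‖y‖ → y ∈ Complex.slitPlane → AnalyticAt ℂ ρ y := fun y hy hs =>
    (hgoodz y hy hs).2.2.2.1.comp (hgoodz y hy hs).2.1
  have hαan : ∀ y : ℂ, δ⁻¹ ^ k < ‖y‖ → y ∈ Complex.slitPlane → AnalyticAt ℂ α y := by
    intro y hy hs
    obtain ⟨-, hsan, -, -, -, -, -, -, -, -, -, -, hΦa, -, -⟩ := hgoodz y hy hs
    exact (hΦa.comp hsan).mul ((hsan.pow M).inv (pow_ne_zero _ (hsroot_ne y)))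
  have hρan₀ : AnalyticAt ℂ ρ z₀ := hρan z₀ hz₀norm hz₀slit
  have hαan₀ : AnalyticAt ℂ α z₀ := hαan z₀ hz₀norm hz₀slit
  have hρ0 : ρ z₀ ≠ 0 := hψne₀
  have hα0 : α z₀ ≠ 0 := mul_ne_zero hΦne₀ (inv_ne_zero (pow_ne_zero _ (hsroot_ne z₀)))
  have hLan : AnalyticAt ℂ L z₀ := hρan₀.div_const.clog hslit₀
  have hgan : AnalyticAt ℂ g z₀ := hρan₀.deriv.div hρan₀ hρ0
  have hRan : AnalyticAt ℂ Rf z₀ := (hman₀.comp hsan₀).inv hmne₀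
  have hβan : AnalyticAt ℂ (deriv α) z₀ := hαan₀.deriv
  have hρderiv : ∀ᶠ y in 𝓝 z₀, HasDerivAt ρ (ρ y * g y) y := by
    filter_upwards [hnear] with y hy
    have h := (hρan y hy.1 hy.2).differentiableAt.hasDerivAt
    refine h.congr_deriv ?_
    rw [hg]
    simp only
    rw [mul_div_cancel₀ _ (hgoodz y hy.1 hy.2).2.2.2.2.1]
  have hLderiv : ∀ᶠ y in 𝓝 z₀, HasDerivAt L (g y) y := by
    filter_upwards [hnear] with y hy
    obtain ⟨-, -, -, -, hne, hslit, -⟩ := hgoodz y hy.1 hy.2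
    have h := ((hρan y hy.1 hy.2).differentiableAt.hasDerivAt.div_const θ).clog hslit
    refine h.congr_deriv ?_
    rw [hg]
    change deriv ρ y / θ / (ρ y / θ) = deriv ρ y / ρ y
    field_simp
  have hαderiv : ∀ᶠ y in 𝓝 z₀, HasDerivAt α (deriv α y) y := by
    filter_upwards [hnear] with y hy using (hαan y hy.1 hy.2).differentiableAt.hasDerivAt
  have hFρ : ∀ᶠ y in 𝓝 z₀, (F.map (Polynomial.evalRingHom y)).eval (ρ y) = 0 := by
    filter_upwards [hnear] with y hy using (hgoodz y hy.1 hy.2).2.2.2.2.2.2.2.2.2.1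
  have hAα : ∀ᶠ y in 𝓝 z₀, (A.map (Polynomial.evalRingHom y)).eval (α y) = 0 := by
    filter_upwards [hnear] with y hy using (hgoodz y hy.1 hy.2).2.2.2.2.2.2.2.2.2.2.2.2.2.2
  -- `g` and `α'` are algebraic (irreducibility of `F`, `A`), and `g(z₀) ≠ 1`
  have hgalg := isAlgebraic_logDeriv_of_irreducible hρan₀ hgan hρderiv hFirr hF1 hρ0 hFρ
  have hβalg := isAlgebraic_deriv_of_algebraic_branch hαan₀ hβan hαderiv hAirr hA1 hα0 hAα
  have hg1 : g z₀ ≠ 1 := by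
    have hderiv : deriv ρ z₀ = deriv ψ (sroot z₀) * (sroot z₀ * (-(1 / (k : ℂ)) * z₀⁻¹)) :=
      ((hψan₀.differentiableAt.hasDerivAt).comp z₀ (hsroot_deriv z₀ hz₀slit)).deriv
    have hval : g z₀ = -(1 / (k : ℂ)) * G (sroot z₀) := by
      rw [hg, hG]
      simp only [hρ]
      rw [hderiv, ← hsroot_pow z₀ hz₀0, pow_succ]
      field_simp
    intro h1
    rw [hval] at h1
    have hn := congrArg (fun x : ℂ => ‖x‖) h1
    simp only [norm_mul, norm_neg, norm_div, norm_one, Complex.norm_natCast] at hn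
    have hk1 : (1 : ℝ) ≤ k := by exact_mod_cast hk
    have : 1 / (k : ℝ) * ‖G (sroot z₀)‖ < 1 := by
      calc 1 / (k : ℝ) * ‖G (sroot z₀)‖ ≤ 1 * ‖G (sroot z₀)‖ := by
            refine mul_le_mul_of_nonneg_right ?_ (norm_nonneg _)
            rw [div_le_one (by positivity)]; exact hk1
        _ < 1 := by rw [one_mul]; exact hG₀
    linarith
  -- the chart identity and the relation on the `z`-side
  have hR : ∀ᶠ y in 𝓝 z₀, (2 * Real.pi * I) * Rf y ^ k = y - L y - τ := by
    filter_upwards [hnear] with y hy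
    obtain ⟨-, -, -, -, -, -, -, -, hid, -⟩ := hgoodz y hy.1 hy.2
    rw [hRf, hL]
    simp only [hρ]
    rw [inv_pow]
    exact hid
  have hHw : ∀ᶠ y in 𝓝 z₀, (H.map (Polynomial.evalRingHom y)).eval
      (Complex.exp (α y - Pl.eval (Rf y))) = 0 := by
    filter_upwards [hnear] with y hy using (hgoodz y hy.1 hy.2).2.2.2.2.2.2.2.2.2.2.1
  have hPt : k + 1 ≤ Pl.natDegree := by rw [hPl]; exact hM
  refine ⟨z₀, ρ, L, hLan, hρan₀, hρ0, hFρ, hLderiv, ?_⟩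
  exact isAlgebraic_log_of_branchExp_relation_ramified hLan hgan hLderiv hgalg hg1 hαan₀ hβan hαderiv
    hβalg hRan hk hR Pl hPt hH0 hHw

end Summit.Schanuel.Schanuel.Theorems
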